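import Mathlib.Algebra.BigOperators.Field
import Summits.CriticalPhenomena.PercolationContinuityZ3.Theorems.PercNearOneGluingNoHeavyLowerTailFloorSplitStarAlgebra
import HarnessLib

/-!
# `NoHeavyLowerTail` (stmt-CriticalPhenomena-4575) — the star algebra of the one-layer floor-split CIL, PRE-FKG form

Helper file of lemma factory #5 (`prim-lf-5`, gen 12; memo `run/shared/lean/prim/prim-lf-5/PRE-FSCIL.md`).
`--supports stmt-CriticalPhenomena-4575`.  Pure finite-sum algebra, no measure theory, no definitions, no sorries.

With the abstract star data of `FloorSplitOneLayer.starAlgebra` (star weights `w(B) ≥ 0` summing to `1` over `B ⊆ A`,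
`H`-numbers `q, r, n`, the star rows, floor weights `0 ≤ φ_a ≤ w{a}/(w{a} + Σ_{B∌a} w)`), write `u := Σ_{B≠∅} w(B)`
(`= μ(o ↔ A)`), `bad := Σ_{B≠∅} w(B) r_B` and `S_v := Σ_{B≠∅} w(B)·(r_B if v ∈ B else n_v(B))` (`= μ(o ↔ A, N_v ≤ j)`,
the lightness of `v` JOINT with the observer reaching the relays).  Then

  `u · bad ≤ Σ_a φ_a S_a + (u − Σ_a φ_a) · S_c`                                   (`starAlgebra_pre`),

the "pre-FKG" (conditional-on-`{o ↔ A}`) form of the floor-split inequality: dividing by `u²` it says that under the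
star law CONDITIONED on `B ≠ ∅` the conclusion of `starAlgebra` holds with the floor weights `φ/u`.  That is exactly
the proof: `starAlgebra` is applied to `w' := w/u` on `B ≠ ∅` (`w'(∅) := 0`) and `φ' := φ/u`; its floor-weight
hypothesis for `(w', φ')` follows from the one for `(w, φ)` because `(1 − π)(1 − ρ_a) ≥ 1 − π − ρ_a`
(`π = w(∅)`, `ρ_a = Σ_{B∋a,|B|≥2} w`).  The pre form implies the original one (`starAlgebra`) by Harris in the
probabilistic reading, but is strictly stronger as an abstract statement.
-/

namespace Summit.CriticalPhenomena.PercolationContinuityZ3.Theorems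

namespace FloorSplitOneLayer

open Finset

variable {ι : Type*} [DecidableEq ι]

/-- For `a ∈ A`, the families `{{a}}` and `{B ⊆ A : a ∉ B}` are disjoint parts of the power set, so for `w ≥ 0`
their `w`-mass is at most the total mass. [folklore] -/
theorem single_add_sum_not_mem_le (A : Finset ι) {a : ι} (ha : a ∈ A) (w : Finset ι → ℝ)
    (hw0 : ∀ B ∈ A.powerset, 0 ≤ w B) :
    w {a} + ∑ B ∈ A.powerset.filter (fun B => a ∉ B), w B ≤ ∑ B ∈ A.powerset, w B := by
  have hsub : insert {a} (A.powerset.filter fun B => a ∉ B) ⊆ A.powerset := by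
    intro B hB
    rcases mem_insert.1 hB with rfl | hB
    · exact mem_powerset.2 (singleton_subset_iff.2 ha)
    · exact (mem_filter.1 hB).1
  have hnot : ({a} : Finset ι) ∉ A.powerset.filter (fun B => a ∉ B) := by
    simp
  calc w {a} + ∑ B ∈ A.powerset.filter (fun B => a ∉ B), w B
      = ∑ B ∈ insert {a} (A.powerset.filter fun B => a ∉ B), w B := (sum_insert hnot).symm
    _ ≤ ∑ B ∈ A.powerset, w B := sum_le_sum_of_subset_of_nonneg hsub fun B hB _ => hw0 B hB

/-- **The star algebra of the one-layer floor-split CIL, pre-FKG form.**  Under the hypotheses of `starAlgebra`,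
with `u = Σ_{B≠∅} w`, `bad = Σ_{B≠∅} w r` and `S_v = Σ_{B≠∅} w·(r_B if v∈B else n_v(B))`:
`u·bad ≤ Σ_a φ_a S_a + (u − Σ_a φ_a)·S_c`.  Proof: `starAlgebra` for the conditioned star law `w/u` on `B ≠ ∅`
and the floor weights `φ/u`. [this work] -/
theorem starAlgebra_pre (A : Finset ι) (c : ι) (hc : c ∈ A)
    (w : Finset ι → ℝ) (q : ι → ℝ) (r : Finset ι → ℝ) (n : ι → Finset ι → ℝ) (φ : ι → ℝ)
    (hw0 : ∀ B ∈ A.powerset, 0 ≤ w B) (hw1 : ∑ B ∈ A.powerset, w B = 1)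
    (hr1 : ∀ a ∈ A, r {a} = q a)
    (hn1 : ∀ v ∈ A, ∀ B ∈ A.powerset, B.card ≤ 1 → v ∉ B → n v B = q v)
    (hq : ∀ a ∈ A, q a ≤ q c)
    (hrow0 : ∀ B ∈ A.powerset, B.Nonempty → r B ≤ q c)
    (hrow : ∀ B ∈ A.powerset, 2 ≤ B.card → ∀ v ∈ A, v ∉ B → r B + q v - n v B ≤ q c)
    (hφ0 : ∀ a ∈ A, 0 ≤ φ a)
    (hφ1 : ∀ a ∈ A, φ a ≤ w {a} / (w {a} + ∑ B ∈ A.powerset.filter (fun B => a ∉ B), w B)) :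
    (∑ B ∈ A.powerset.filter (fun B => B.Nonempty), w B) *
        ∑ B ∈ A.powerset.filter (fun B => B.Nonempty), w B * r B ≤
      ∑ a ∈ A, φ a * ∑ B ∈ A.powerset.filter (fun B => B.Nonempty), w B * (if a ∈ B then r B else n a B) +
        ((∑ B ∈ A.powerset.filter (fun B => B.Nonempty), w B) - ∑ a ∈ A, φ a) *
          ∑ B ∈ A.powerset.filter (fun B => B.Nonempty), w B * (if c ∈ B then r B else n c B) := by
  set P1 : Finset (Finset ι) := A.powerset.filter (fun B => B.Nonempty) with hP1
  set u : ℝ := ∑ B ∈ P1, w B with hu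
  set S : ι → ℝ := fun v => ∑ B ∈ P1, w B * (if v ∈ B then r B else n v B) with hS
  set bad : ℝ := ∑ B ∈ P1, w B * r B with hbad
  set Φ : ℝ := ∑ a ∈ A, φ a with hΦ
  have hP1P : ∀ B ∈ P1, B ∈ A.powerset := fun B hB => (mem_filter.1 hB).1
  have hP1w : ∀ B ∈ P1, 0 ≤ w B := fun B hB => hw0 B (hP1P B hB)
  have hu0 : 0 ≤ u := sum_nonneg hP1w
  -- `u = 1 − w ∅`
  have hπu : w ∅ + u = 1 := by
    rw [← hw1, hu, hP1, ← sum_filter_add_sum_filter_not A.powerset (fun B => B.Nonempty) w, add_comm]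
    congr 1
    have : A.powerset.filter (fun B => ¬ B.Nonempty) = {∅} := by
      ext B
      simp only [mem_filter, mem_powerset, not_nonempty_iff_eq_empty, mem_singleton]
      constructor
      · rintro ⟨_, rfl⟩; rfl
      · rintro rfl; exact ⟨empty_subset _, rfl⟩
    rw [this, sum_singleton]
  rcases hu0.eq_or_lt with hu00 | hupos
  · -- degenerate star: all the mass sits on `∅`, every nonempty star has weight `0`
    have hwz : ∀ B ∈ P1, w B = 0 := (sum_eq_zero_iff_of_nonneg hP1w).1 hu00.symm
    have hS0 : ∀ v, S v = 0 := fun v => sum_eq_zero fun B hB => by rw [hwz B hB, zero_mul]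
    have hbad0 : bad = 0 := sum_eq_zero fun B hB => by rw [hwz B hB, zero_mul]
    show u * bad ≤ ∑ a ∈ A, φ a * S a + (u - Φ) * S c
    simp only [hS0, hbad0, mul_zero, sum_const_zero, add_zero]
    exact le_rfl
  -- the conditioned star law and the rescaled floor weights
  set w' : Finset ι → ℝ := fun B => if B.Nonempty then w B / u else 0 with hw'
  set φ' : ι → ℝ := fun a => φ a / u with hφ'
  have hw'0 : ∀ B ∈ A.powerset, 0 ≤ w' B := by
    intro B hB
    simp only [hw']
    split_ifs with h
    · exact div_nonneg (hw0 B hB) hu0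
    · exact le_rfl
  -- sums against `w'` are the `P1`-sums against `w`, divided by `u`
  have hsum' : ∀ X : Finset ι → ℝ, ∑ B ∈ A.powerset, w' B * X B = (∑ B ∈ P1, w B * X B) / u := by
    intro X
    rw [hP1, sum_filter, sum_div]
    refine sum_congr rfl fun B _ => ?_
    simp only [hw']
    split_ifs with h
    · ring
    · simp
  have hw'1 : ∑ B ∈ A.powerset, w' B = 1 := by
    have := hsum' (fun _ => 1)
    simp only [mul_one] at this
    rw [this, ← hu]
    exact div_self hupos.ne'
  have hw'a : ∀ a ∈ A, w' {a} = w {a} / u := fun a _ => by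
    simp only [hw', if_pos (singleton_nonempty a)]
  have hφ'0 : ∀ a ∈ A, 0 ≤ φ' a := fun a ha => div_nonneg (hφ0 a ha) hu0
  -- the floor-weight hypothesis for `(w', φ')`
  have hφ'1 : ∀ a ∈ A, φ' a ≤ w' {a} / (w' {a} + ∑ B ∈ A.powerset.filter (fun B => a ∉ B), w' B) := by
    intro a ha
    -- `T` = the `w`-mass of the nonempty stars missing `a`; `Σ_{B∌a} w = w ∅ + T` and `Σ_{B∌a} w' = T/u`
    set T : ℝ := ∑ B ∈ (A.powerset.filter (fun B => a ∉ B)).filter (fun B => B.Nonempty), w B with hT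
    have hT0 : 0 ≤ T := sum_nonneg fun B hB => hw0 B (mem_filter.1 (mem_filter.1 hB).1).1
    have hwa0 : 0 ≤ w {a} := hw0 {a} (mem_powerset.2 (singleton_subset_iff.2 ha))
    have hπ0 : 0 ≤ w ∅ := hw0 ∅ (mem_powerset.2 (empty_subset _))
    have hsplit : ∑ B ∈ A.powerset.filter (fun B => a ∉ B), w B = w ∅ + T := by
      rw [← sum_filter_add_sum_filter_not (A.powerset.filter fun B => a ∉ B) (fun B => B.Nonempty) w, hT,
        add_comm]
      congr 1
      have : (A.powerset.filter (fun B => a ∉ B)).filter (fun B => ¬ B.Nonempty) = {∅} := by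
        ext B
        simp only [mem_filter, mem_powerset, not_nonempty_iff_eq_empty, mem_singleton]
        constructor
        · rintro ⟨_, rfl⟩; rfl
        · rintro rfl; exact ⟨⟨empty_subset _, by simp⟩, rfl⟩
      rw [this, sum_singleton]
    have hsplit' : ∑ B ∈ A.powerset.filter (fun B => a ∉ B), w' B = T / u := by
      have e : ∑ B ∈ (A.powerset.filter (fun B => a ∉ B)).filter (fun B => B.Nonempty), w B / u =
          ∑ B ∈ A.powerset.filter (fun B => a ∉ B), (if B.Nonempty then w B / u else 0) := sum_filter _ _
      rw [hT, sum_div, e]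
    -- total mass: `w{a} + w ∅ + T ≤ 1`, i.e. `w{a} + T ≤ u`
    have hmass : w {a} + (w ∅ + T) ≤ 1 := by
      rw [← hsplit, ← hw1]
      exact single_add_sum_not_mem_le A ha w hw0
    have hle_u : w {a} + T ≤ u := by linarith [hπu]
    -- from `φ_a (w{a} + w∅ + T) ≤ w{a}` to `φ_a (w{a} + T) ≤ u · w{a}`… in the form needed
    have h1 := hφ1 a ha
    rw [hsplit] at h1
    rw [hφ', hw'a a ha, hsplit']
    -- case on the denominators
    by_cases hD : w {a} + T = 0
    · -- then `w{a} = 0` and `φ_a ≤ 0`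
      have hwa : w {a} = 0 := by linarith
      have hφle : φ a ≤ 0 := by
        have : w {a} / (w {a} + (w ∅ + T)) = 0 := by rw [hwa, zero_div]
        linarith [this ▸ h1]
      have hr : 0 ≤ w {a} / u / (w {a} / u + T / u) := by positivity
      exact le_trans (div_nonpos_of_nonpos_of_nonneg hφle hu0) hr
    · have hDpos : 0 < w {a} + T := lt_of_le_of_ne (add_nonneg hwa0 hT0) (Ne.symm hD)
      have hD1pos : 0 < w {a} + (w ∅ + T) := by linarith
      -- `φ_a · (w{a} + w∅ + T) ≤ w{a}`
      have h2 : φ a * (w {a} + (w ∅ + T)) ≤ w {a} := (le_div_iff₀ hD1pos).1 h1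
      -- the key estimate `φ_a (w{a} + T) ≤ u w{a}`:
      -- `φ_a (w{a}+T) = φ_a (w{a}+w∅+T) − φ_a w∅ ≤ w{a} − φ_a w∅`… not signed; use instead
      -- `u·w{a} − φ_a (w{a}+T) ≥ u w{a} − w{a}(w{a}+T)/(w{a}+w∅+T) = w{a}[u − (w{a}+T)/(w{a}+w∅+T)] ≥ 0`
      -- since `(w{a}+T) ≤ u (w{a}+w∅+T)` iff `(w{a}+T)(1−u) ≤ u w∅` iff `(w{a}+T) w∅ ≤ u w∅` (as `1 − u = w∅`).
      have h3 : (w {a} + T) ≤ u * (w {a} + (w ∅ + T)) := by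
        have h1u : 1 - u = w ∅ := by linarith [hπu]
        nlinarith [hle_u, hπ0, hDpos.le, h1u]
      have h4 : φ a * (w {a} + T) ≤ u * w {a} := by
        have hφa0 := hφ0 a ha
        -- φ_a (w{a}+T) ≤ φ_a · u (w{a}+w∅+T) = u · φ_a (w{a}+w∅+T) ≤ u w{a}
        calc φ a * (w {a} + T) ≤ φ a * (u * (w {a} + (w ∅ + T))) :=
              mul_le_mul_of_nonneg_left h3 hφa0
          _ = u * (φ a * (w {a} + (w ∅ + T))) := by ring
          _ ≤ u * w {a} := mul_le_mul_of_nonneg_left h2 hu0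
      -- conclude in division form
      have hden : w {a} / u + T / u = (w {a} + T) / u := by ring
      rw [hden, div_div_div_cancel_right₀ hupos.ne', div_le_div_iff₀ hupos hDpos]
      linarith [h4]
  -- apply the star algebra to `(w', φ')`
  have key := starAlgebra A c hc w' q r n φ' hw'0 hw'1 hr1 hn1 hq hrow0 hrow hφ'0 hφ'1
  -- read the `w'`-sums
  have hL : ∑ B ∈ A.powerset.filter (fun B => B.Nonempty), w' B * r B = bad / u := by
    rw [← hsum' r, sum_filter]
    refine sum_congr rfl fun B _ => ?_
    simp only [hw']
    split_ifs <;> simp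
  have hU : ∑ B ∈ A.powerset.filter (fun B => B.Nonempty), w' B = 1 := by
    rw [← hw'1, sum_filter]
    refine sum_congr rfl fun B _ => ?_
    simp only [hw']
    split_ifs <;> simp
  have hSv : ∀ v, ∑ B ∈ A.powerset, w' B * (if v ∈ B then r B else n v B) = S v / u := fun v =>
    hsum' (fun B => if v ∈ B then r B else n v B)
  have hΦ' : ∑ a ∈ A, φ' a = Φ / u := by rw [hΦ, sum_div]
  have hsumφ : ∑ a ∈ A, φ' a * ∑ B ∈ A.powerset, w' B * (if a ∈ B then r B else n a B) =
      (∑ a ∈ A, φ a * S a) / u ^ 2 := by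
    rw [sum_div]
    refine sum_congr rfl fun a _ => ?_
    rw [hSv a, hφ']
    field_simp
  rw [hL, hsumφ, hU, hΦ', hSv c] at key
  -- multiply through by `u²`
  have hu2 : 0 < u ^ 2 := by positivity
  have key' : bad / u * u ^ 2 ≤ ((∑ a ∈ A, φ a * S a) / u ^ 2 + (1 - Φ / u) * (S c / u)) * u ^ 2 :=
    mul_le_mul_of_nonneg_right key hu2.le
  have e1 : bad / u * u ^ 2 = u * bad := by field_simp
  have e2 : ((∑ a ∈ A, φ a * S a) / u ^ 2 + (1 - Φ / u) * (S c / u)) * u ^ 2 =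
      ∑ a ∈ A, φ a * S a + (u - Φ) * S c := by field_simp
  rw [e1, e2] at key'
  exact key'

end FloorSplitOneLayer

end Summit.CriticalPhenomena.PercolationContinuityZ3.Theorems
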